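import Summits.KontsevichZagierPeriods.KontsevichZagierPeriods.Theorems.HermiteRigidityReductionRigidityDupJoinKernel
import Summits.KontsevichZagierPeriods.KontsevichZagierPeriods.Theorems.HermiteRigidityReductionRigidityDupMoveGen
import Summits.KontsevichZagierPeriods.KontsevichZagierPeriods.Theorems.HermiteRigidityDilogRigidityCubeSeriesLevel
import Literature.NumberTheory.DiophantineApproximation.PolylogTwoPointsLinearIndependence

/-!
# `ReductionRigidity` (stmt-KontsevichZagierPeriods-3407), line `Sketch`: THE DUPLICATION JOIN ISLAND IN EVERY WEIGHT
# (`stub_dupJoinKernelGen`), UNCONDITIONAL for `log N ≥ 4(w+1)³` (`stub_dupJoinKernelGenUnconditional`)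

Route `KontsevichZagierPeriods/HermiteRigidity`, crux `ReductionRigidity` (stmt-3407, summit-equivalent; skeleton
`Cruxes/ReductionRigidity/Lines/Sketch.lean` v7). Lead seat c7, cycle 2 (growth item G11). Lead c6 proved the three-level island
`stub_dupJoinKernel` in weights `≤ 2`; here the SAME island is proved in EVERY weight `w`: on the sector generated by all box
generators `[□ʲ, x^a/(ν − ∏x)^m]` (`j ≤ w`) at the three levels `ν = N`, `ν = −N`, `ν = N²`, Conjecture 1 of Kontsevich–Zagier
holds in kernel form as soon as `1, Li_s(1/N), Li_s(−1/N)` (`s ≤ w`) are ℚ-linearly independent (`stub_dupJoinKernelGen`,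
rigidity inlined) — and that rigidity is a THEOREM of the tree for `log N ≥ 4(w+1)³`
(`Literature.NumberTheory.DiophantineApproximation.one_polylog_twoPoints_linearIndependent`, the parity Hermite–Padé programme
`PolylogTwoPoint*.lean` of this seat), whence `stub_dupJoinKernelGenUnconditional`. The cross-level content is the weight-`i`
DUPLICATION move chain `[□ⁱ, ε/(N² − ∏p)] ≡ 2^{i−1}[□ⁱ, ε/(N − ∏p)] + 2^{i−1}[□ⁱ, ε/((−N) − ∏p)]` (`stub_dupMoveGen`: the squaring
chart in dimension `i` and one partial fraction), used twice: through soundness for the value relation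
`Li_i(1/N²) = 2^{i−1}(Li_i(1/N) + Li_i(−1/N))` and as the move that kills the `N²`-part. Normal forms: c4's `genReduction` at each level
(`levelNormalForm`), bookkeeping by `two_carriers_neg` / `three_carriers_zero`.

References: M. Kontsevich, D. Zagier, *Periods* (2001), §1.2 [cite: KontsevichZagier2001, §1.2]; S. David, N. Hirata-Kohno,
M. Kawashima, Moscow J. Comb. Number Theory 9 (2020), Thm 2.1 [cite: DavidHirataKohnoKawashima2020, Thm 2.1]. No definitions are
introduced.
-/

noncomputable section

open MeasureTheory Set MvPolynomial

namespace Summit.KontsevichZagierPeriods.HermiteRigidity.ReductionRigidity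

open Literature.NumberTheory.Transcendental
open Literature.NumberTheory.Transcendental.KZ

/-- **Stub `stub_dupJoinKernelGen`** (sub-goal of crux `ReductionRigidity`, stmt-3407, line `Sketch`, lead c7 cycle 2): **the
duplication join island in every weight, rigidity inlined.** For integers `w` and `N ≥ 2`: IF the `2w + 1` numbers
`1, ∫_□ⁱ dp/(N − ∏p), ∫_□ⁱ dp/((−N) − ∏p)` (`1 ≤ i ≤ w`; `= 1, Li_i(1/N), Li_i(−1/N)`) are ℚ-linearly independent, THEN Conjecture 1
of Kontsevich–Zagier holds in kernel form on the sector generated by ALL box generators `[□ʲ, x^a/(ν − ∏x)^m]`, `j ≤ w`, at the THREE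
levels `ν = N`, `ν = −N`, `ν = N²`: every `ℤ`-combination of value `0` is a chain of moves. Reductions: `levelNormalForm` at each level;
the level `N²` is eliminated by the weight-`i` duplication move chains `stub_dupMoveGen` (`1 ≤ i ≤ w`), each used twice (soundness ⇒ the
value relation; the move itself ⇒ kills the `N²`-part), and the three constants are one relation (`three_carriers_zero`).
[cite: KontsevichZagier2001, §1.2] [cite: DavidHirataKohnoKawashima2020, Thm 2.1] -/
theorem stub_dupJoinKernelGen : ∀ (w N : ℕ), 2 ≤ N →
    (∀ (a : ℚ) (b c : ℕ → ℚ),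
      (a : ℝ) + ∑ i ∈ Finset.range w, (b i : ℝ) * (∫ p in cube (i + 1), 1 / ((N : ℝ) - ∏ l, p l)) +
          ∑ i ∈ Finset.range w, (c i : ℝ) * (∫ p in cube (i + 1), 1 / ((-(N : ℝ)) - ∏ l, p l)) = 0 →
        a = 0 ∧ (∀ i ∈ Finset.range w, b i = 0) ∧ (∀ i ∈ Finset.range w, c i = 0)) →
    ∀ c ∈ AddSubgroup.closure
      ({c | ∃ (j : ℕ) (r : IntegralRep j) (a : Fin j → ℕ) (m : ℕ), j ≤ w ∧ r.domain = cube j ∧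
          EqOn r.integrand (fun p => (∏ l, p l ^ a l) / ((N : ℝ) - ∏ l, p l) ^ m) (cube j) ∧ c = KZ.of r} ∪
        {c | ∃ (j : ℕ) (r : IntegralRep j) (a : Fin j → ℕ) (m : ℕ), j ≤ w ∧ r.domain = cube j ∧
          EqOn r.integrand (fun p => (∏ l, p l ^ a l) / ((-(N : ℝ)) - ∏ l, p l) ^ m) (cube j) ∧ c = KZ.of r} ∪
        {c | ∃ (j : ℕ) (r : IntegralRep j) (a : Fin j → ℕ) (m : ℕ), j ≤ w ∧ r.domain = cube j ∧
          EqOn r.integrand (fun p => (∏ l, p l ^ a l) / ((N : ℝ) ^ 2 - ∏ l, p l) ^ m) (cube j) ∧ c = KZ.of r}),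
      KZ.eval c = 0 → c ∈ KZ.relations := by
  intro w N hN hrig c hc h0
  have hν₁ : (1 : ℚ) < N ∨ (N : ℚ) < 0 := natLevel hN
  have h2Q : (2 : ℚ) ≤ N := by exact_mod_cast hN
  have hν₂ : (1 : ℚ) < (-(N : ℚ)) ∨ (-(N : ℚ)) < 0 := Or.inr (by linarith)
  have hν₃ : (1 : ℚ) < ((N : ℚ) ^ 2) ∨ ((N : ℚ) ^ 2) < 0 := Or.inl (by nlinarith)
  have c₁R : ((N : ℚ) : ℝ) = (N : ℝ) := by push_cast; ring
  have c₂R : ((-(N : ℚ) : ℚ) : ℝ) = -(N : ℝ) := by push_cast; ring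
  have c₃R : ((((N : ℚ) ^ 2 : ℚ)) : ℝ) = (N : ℝ) ^ 2 := by push_cast; ring
  -- split `c` along the three levels and take normal forms
  rw [AddSubgroup.closure_union, AddSubgroup.closure_union] at hc
  obtain ⟨xy, hxy, z, hz, rfl⟩ := AddSubgroup.mem_sup.1 hc
  obtain ⟨x, hx, y, hy, rfl⟩ := AddSubgroup.mem_sup.1 hxy
  obtain ⟨α, s, hs, hxs⟩ := levelNormalForm hν₁ w x (by
    refine AddSubgroup.closure_mono (fun c hc => ?_) hx
    obtain ⟨j, r, a, m, hj, hr, hri, rfl⟩ := hc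
    exact ⟨j, r, a, m, hj, hr, fun p hp => by rw [hri hp, c₁R], rfl⟩)
  obtain ⟨β, t, ht, hyt⟩ := levelNormalForm hν₂ w y (by
    refine AddSubgroup.closure_mono (fun c hc => ?_) hy
    obtain ⟨j, r, a, m, hj, hr, hri, rfl⟩ := hc
    exact ⟨j, r, a, m, hj, hr, fun p hp => by rw [hri hp, c₂R], rfl⟩)
  obtain ⟨γ, u, hu, hzu⟩ := levelNormalForm hν₃ w z (by
    refine AddSubgroup.closure_mono (fun c hc => ?_) hz
    obtain ⟨j, r, a, m, hj, hr, hri, rfl⟩ := hc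
    exact ⟨j, r, a, m, hj, hr, fun p hp => by rw [hri hp, c₃R], rfl⟩)
  -- the duplication move chains in weights `i + 1`, `i < w`, scaled by `γ (i+1)`
  choose sP hsP hsPi using fun i : ℕ => exists_nfRep (i := i + 1) hν₁ (2 ^ i * γ (i + 1))
  choose tP htP htPi using fun i : ℕ => exists_nfRep (i := i + 1) hν₂ (2 ^ i * γ (i + 1))
  have hmove : ∀ i, KZ.of (u (i + 1)) - KZ.of (sP i) - KZ.of (tP i) ∈ KZ.relations := by
    intro i
    refine stub_dupMoveGen N hN (i + 1) (Nat.succ_pos i) (γ (i + 1)) (u (i + 1)) (sP i) (tP i) (hu (i + 1)).1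
      (fun p hp => by rw [(hu (i + 1)).2 hp, c₃R]) (hsP i) (fun p hp => ?_) (htP i) (fun p hp => ?_)
    · rw [hsPi i hp, Nat.add_sub_cancel, c₁R]
    · rw [htPi i hp, Nat.add_sub_cancel, c₂R]
  -- VALUES
  set I : ℕ → ℝ → ℝ := fun i ν => ∫ p in cube i, 1 / (ν - ∏ l, p l) with hI
  have I0 : ∀ ν : ℚ, (∫ p in cube 0, 1 / ((ν : ℝ) - ∏ l, p l)) = 1 / ((ν : ℝ) - 1) := integral_cube_zero_level
  have evx : KZ.eval x = ∑ i ∈ Finset.range (w + 1), (α i : ℝ) * I i N := by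
    have e := eval_eq_zero_of_mem_relations hxs
    rw [map_sub, map_sum, sub_eq_zero] at e
    rw [e]
    refine Finset.sum_congr rfl fun i _ => ?_
    rw [eval_nfRep (hs i).1 (hs i).2, c₁R]
  have evy : KZ.eval y = ∑ i ∈ Finset.range (w + 1), (β i : ℝ) * I i (-(N : ℝ)) := by
    have e := eval_eq_zero_of_mem_relations hyt
    rw [map_sub, map_sum, sub_eq_zero] at e
    rw [e]
    refine Finset.sum_congr rfl fun i _ => ?_
    rw [eval_nfRep (ht i).1 (ht i).2, c₂R]
  have evz : KZ.eval z = ∑ i ∈ Finset.range (w + 1), (γ i : ℝ) * I i ((N : ℝ) ^ 2) := by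
    have e := eval_eq_zero_of_mem_relations hzu
    rw [map_sub, map_sum, sub_eq_zero] at e
    rw [e]
    refine Finset.sum_congr rfl fun i _ => ?_
    rw [eval_nfRep (hu i).1 (hu i).2, c₃R]
  -- split off the constants `i = 0`
  have evx' : KZ.eval x = (α 0 : ℝ) * (1 / ((N : ℝ) - 1)) + ∑ i ∈ Finset.range w, (α (i + 1) : ℝ) * I (i + 1) N := by
    rw [evx, Finset.sum_range_succ', add_comm]
    congr 1
    simp only [hI]
    rw [← c₁R, I0]
  have evy' : KZ.eval y = (β 0 : ℝ) * (1 / (-(N : ℝ) - 1)) +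
      ∑ i ∈ Finset.range w, (β (i + 1) : ℝ) * I (i + 1) (-(N : ℝ)) := by
    rw [evy, Finset.sum_range_succ', add_comm]
    congr 1
    simp only [hI]
    rw [← c₂R, I0]
  have evz' : KZ.eval z = (γ 0 : ℝ) * (1 / ((N : ℝ) ^ 2 - 1)) +
      ∑ i ∈ Finset.range w, (γ (i + 1) : ℝ) * I (i + 1) ((N : ℝ) ^ 2) := by
    rw [evz, Finset.sum_range_succ', add_comm]
    congr 1
    simp only [hI]
    rw [← c₃R, I0]
  -- the duplication VALUE relations (soundness of the move chains), summed
  have hdup : ∀ i, (γ (i + 1) : ℝ) * I (i + 1) ((N : ℝ) ^ 2) -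
      ((2 ^ i * γ (i + 1) : ℚ) : ℝ) * I (i + 1) N - ((2 ^ i * γ (i + 1) : ℚ) : ℝ) * I (i + 1) (-(N : ℝ)) = 0 := by
    intro i
    have e := eval_eq_zero_of_mem_relations (hmove i)
    rw [map_sub, map_sub, eval_nfRep (hu (i + 1)).1 (hu (i + 1)).2, eval_nfRep (hsP i) (hsPi i),
      eval_nfRep (htP i) (htPi i), c₁R, c₂R, c₃R] at e
    simpa only [hI] using e
  have hdupSum : ∑ i ∈ Finset.range w, (γ (i + 1) : ℝ) * I (i + 1) ((N : ℝ) ^ 2) =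
      ∑ i ∈ Finset.range w, ((2 ^ i * γ (i + 1) : ℚ) : ℝ) * I (i + 1) N +
        ∑ i ∈ Finset.range w, ((2 ^ i * γ (i + 1) : ℚ) : ℝ) * I (i + 1) (-(N : ℝ)) := by
    rw [← Finset.sum_add_distrib]
    exact Finset.sum_congr rfl fun i _ => by linear_combination hdup i
  -- the value of `c`, in the shape of the rigidity hypothesis
  have h0' : KZ.eval x + KZ.eval y + KZ.eval z = 0 := by rwa [map_add, map_add] at h0
  have hB : ∑ i ∈ Finset.range w, ((α (i + 1) + 2 ^ i * γ (i + 1) : ℚ) : ℝ) * I (i + 1) N =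
      ∑ i ∈ Finset.range w, (α (i + 1) : ℝ) * I (i + 1) N +
        ∑ i ∈ Finset.range w, ((2 ^ i * γ (i + 1) : ℚ) : ℝ) * I (i + 1) N := by
    rw [← Finset.sum_add_distrib]
    exact Finset.sum_congr rfl fun i _ => by push_cast; ring
  have hC : ∑ i ∈ Finset.range w, ((β (i + 1) + 2 ^ i * γ (i + 1) : ℚ) : ℝ) * I (i + 1) (-(N : ℝ)) =
      ∑ i ∈ Finset.range w, (β (i + 1) : ℝ) * I (i + 1) (-(N : ℝ)) +
        ∑ i ∈ Finset.range w, ((2 ^ i * γ (i + 1) : ℚ) : ℝ) * I (i + 1) (-(N : ℝ)) := by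
    rw [← Finset.sum_add_distrib]
    exact Finset.sum_congr rfl fun i _ => by push_cast; ring
  have hval : ((α 0 / ((N : ℚ) - 1) + β 0 / (-(N : ℚ) - 1) + γ 0 / ((N : ℚ) ^ 2 - 1) : ℚ) : ℝ) +
      ∑ i ∈ Finset.range w, ((α (i + 1) + 2 ^ i * γ (i + 1) : ℚ) : ℝ) *
        (∫ p in cube (i + 1), 1 / ((N : ℝ) - ∏ l, p l)) +
      ∑ i ∈ Finset.range w, ((β (i + 1) + 2 ^ i * γ (i + 1) : ℚ) : ℝ) *
        (∫ p in cube (i + 1), 1 / ((-(N : ℝ)) - ∏ l, p l)) = 0 := by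
    have eB : ∑ i ∈ Finset.range w, ((α (i + 1) + 2 ^ i * γ (i + 1) : ℚ) : ℝ) *
        (∫ p in cube (i + 1), 1 / ((N : ℝ) - ∏ l, p l)) =
        ∑ i ∈ Finset.range w, ((α (i + 1) + 2 ^ i * γ (i + 1) : ℚ) : ℝ) * I (i + 1) N := by
      simp only [hI]
    have eC : ∑ i ∈ Finset.range w, ((β (i + 1) + 2 ^ i * γ (i + 1) : ℚ) : ℝ) *
        (∫ p in cube (i + 1), 1 / ((-(N : ℝ)) - ∏ l, p l)) =
        ∑ i ∈ Finset.range w, ((β (i + 1) + 2 ^ i * γ (i + 1) : ℚ) : ℝ) * I (i + 1) (-(N : ℝ)) := by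
      simp only [hI]
    rw [eB, eC, hB, hC]
    have hN1 : (N : ℝ) - 1 ≠ 0 := by
      have : (2 : ℝ) ≤ N := by exact_mod_cast hN
      linarith
    have hN2 : -(N : ℝ) - 1 ≠ 0 := by
      have : (2 : ℝ) ≤ N := by exact_mod_cast hN
      linarith
    have hN3 : (N : ℝ) ^ 2 - 1 ≠ 0 := by
      have : (2 : ℝ) ≤ N := by exact_mod_cast hN
      nlinarith
    push_cast at hdupSum ⊢
    linear_combination h0' - evx' - evy' - evz' - hdupSum
  obtain ⟨hA, hBi, hCi⟩ := hrig _ (fun i => α (i + 1) + 2 ^ i * γ (i + 1)) (fun i => β (i + 1) + 2 ^ i * γ (i + 1)) hval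
  -- RELATIONS: weight `i + 1` — the move chain kills `u (i+1) + s (i+1) + t (i+1)`
  have hS : ∀ i ∈ Finset.range w, KZ.of (s (i + 1)) + KZ.of (t (i + 1)) + KZ.of (u (i + 1)) ∈ KZ.relations := by
    intro i hi
    have hαi : α (i + 1) = -(2 ^ i * γ (i + 1)) := by linarith [hBi i hi]
    have hβi : β (i + 1) = -(2 ^ i * γ (i + 1)) := by linarith [hCi i hi]
    have hb : KZ.of (sP i) + KZ.of (s (i + 1)) ∈ KZ.relations :=
      two_carriers_neg (D := cube (i + 1)) (fun b p => (b : ℝ) / ((N : ℝ) - ∏ l, p l)) (fun b b' p => by push_cast; ring)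
        (fun p => by simp) (fun b => by
          obtain ⟨r, hr, hri⟩ := exists_nfRep (i := i + 1) hν₁ b
          exact ⟨r, hr, fun p hp => by rw [hri hp, c₁R]⟩) (β := 2 ^ i * γ (i + 1))
        (hsP i) (fun p hp => by rw [hsPi i hp, c₁R]) (hs (i + 1)).1
        (fun p hp => by rw [(hs (i + 1)).2 hp, hαi, c₁R])
    have hc' : KZ.of (tP i) + KZ.of (t (i + 1)) ∈ KZ.relations :=
      two_carriers_neg (D := cube (i + 1)) (fun b p => (b : ℝ) / ((-(N : ℝ)) - ∏ l, p l)) (fun b b' p => by push_cast; ring)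
        (fun p => by simp) (fun b => by
          obtain ⟨r, hr, hri⟩ := exists_nfRep (i := i + 1) hν₂ b
          exact ⟨r, hr, fun p hp => by rw [hri hp, c₂R]⟩) (β := 2 ^ i * γ (i + 1))
        (htP i) (fun p hp => by rw [htPi i hp, c₂R]) (ht (i + 1)).1
        (fun p hp => by rw [(ht (i + 1)).2 hp, hβi, c₂R])
    have : KZ.of (s (i + 1)) + KZ.of (t (i + 1)) + KZ.of (u (i + 1)) =
        (KZ.of (u (i + 1)) - KZ.of (sP i) - KZ.of (tP i)) + (KZ.of (sP i) + KZ.of (s (i + 1))) +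
          (KZ.of (tP i) + KZ.of (t (i + 1))) := by abel
    rw [this]
    exact KZ.relations.add_mem (KZ.relations.add_mem (hmove i) hb) hc'
  -- weight zero: three constants summing to `0`
  have hZ : KZ.of (s 0) + KZ.of (t 0) + KZ.of (u 0) ∈ KZ.relations := by
    refine three_carriers_zero (D := cube 0) (fun b _ => (b : ℝ)) (fun b b' p => by push_cast; ring)
      (fun p => by simp) (fun b => exists_nf0 b) (β₁ := α 0 / ((N : ℚ) - 1)) (β₂ := β 0 / (-(N : ℚ) - 1))
      (β₃ := γ 0 / ((N : ℚ) ^ 2 - 1)) hA (hs 0).1 (fun p hp => ?_) (ht 0).1 (fun p hp => ?_) (hu 0).1 (fun p hp => ?_)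
    · rw [(hs 0).2 hp]; simp [Finset.univ_eq_empty]
    · rw [(ht 0).2 hp]; simp [Finset.univ_eq_empty]
    · rw [(hu 0).2 hp]; simp [Finset.univ_eq_empty]
  -- all weights together
  have hAll : ∑ i ∈ Finset.range (w + 1), (KZ.of (s i) + KZ.of (t i) + KZ.of (u i)) ∈ KZ.relations := by
    rw [Finset.sum_range_succ']
    exact KZ.relations.add_mem (KZ.relations.sum_mem fun i hi => hS i hi) hZ
  have : x + y + z = (x - ∑ i ∈ Finset.range (w + 1), KZ.of (s i)) + (y - ∑ i ∈ Finset.range (w + 1), KZ.of (t i)) +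
      (z - ∑ i ∈ Finset.range (w + 1), KZ.of (u i)) +
      ∑ i ∈ Finset.range (w + 1), (KZ.of (s i) + KZ.of (t i) + KZ.of (u i)) := by
    rw [Finset.sum_add_distrib, Finset.sum_add_distrib]
    abel
  rw [this]
  exact KZ.relations.add_mem (KZ.relations.add_mem (KZ.relations.add_mem hxs hyt) hzu) hAll

/-- **Stub `stub_dupJoinKernelGenUnconditional`**: **THE DUPLICATION JOIN ISLAND IN EVERY WEIGHT, UNCONDITIONAL** for
`log N ≥ 4(w+1)³` (`w ≥ 1`): Conjecture 1 of Kontsevich–Zagier in kernel form on the three-level box sector `{N, −N, N²}` in all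
dimensions `≤ w`, with NO hypothesis — `stub_dupJoinKernelGen` fed with the PROVED rigidity
`one_polylog_twoPoints_linearIndependent` (`1, Li_s(1/N), Li_s(−1/N)`, `s ≤ w`, ℚ-independent), the cube values being
`Li_i(±1/N)` by `stub_cubeIntegralSeriesLevel` and `integral_cube_one_div_prod_absLevel`.
[cite: KontsevichZagier2001, §1.2] [cite: DavidHirataKohnoKawashima2020, Thm 2.1] -/
theorem stub_dupJoinKernelGenUnconditional : ∀ (w N : ℕ), 1 ≤ w → 4 * ((w : ℝ) + 1) ^ 3 ≤ Real.log N →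
    ∀ c ∈ AddSubgroup.closure
      ({c | ∃ (j : ℕ) (r : IntegralRep j) (a : Fin j → ℕ) (m : ℕ), j ≤ w ∧ r.domain = cube j ∧
          EqOn r.integrand (fun p => (∏ l, p l ^ a l) / ((N : ℝ) - ∏ l, p l) ^ m) (cube j) ∧ c = KZ.of r} ∪
        {c | ∃ (j : ℕ) (r : IntegralRep j) (a : Fin j → ℕ) (m : ℕ), j ≤ w ∧ r.domain = cube j ∧
          EqOn r.integrand (fun p => (∏ l, p l ^ a l) / ((-(N : ℝ)) - ∏ l, p l) ^ m) (cube j) ∧ c = KZ.of r} ∪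
        {c | ∃ (j : ℕ) (r : IntegralRep j) (a : Fin j → ℕ) (m : ℕ), j ≤ w ∧ r.domain = cube j ∧
          EqOn r.integrand (fun p => (∏ l, p l ^ a l) / ((N : ℝ) ^ 2 - ∏ l, p l) ^ m) (cube j) ∧ c = KZ.of r}),
      KZ.eval c = 0 → c ∈ KZ.relations := by
  intro w N hw hlog
  -- `N ≥ 2` from `log N ≥ 32`
  have hw1 : (1 : ℝ) ≤ w := by exact_mod_cast hw
  have hL : (32 : ℝ) ≤ Real.log N := by
    calc (32 : ℝ) = 4 * 2 ^ 3 := by norm_num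
      _ ≤ 4 * ((w : ℝ) + 1) ^ 3 := by gcongr; linarith
      _ ≤ Real.log N := hlog
  have hN0 : (N : ℝ) ≠ 0 := by
    intro h0; rw [h0, Real.log_zero] at hL; linarith
  have hNpos : (0 : ℝ) < N := lt_of_le_of_ne (Nat.cast_nonneg N) (Ne.symm hN0)
  have hNR : (2 : ℝ) ≤ N := by
    have h1 : Real.log N ≤ (N : ℝ) - 1 := Real.log_le_sub_one_of_pos hNpos
    linarith
  have hN : 2 ≤ N := by exact_mod_cast hNR
  refine stub_dupJoinKernelGen w N hN fun a b c h => ?_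
  -- the cube values as polylogarithm series
  have IP : ∀ i, (∫ p in cube (i + 1), 1 / ((N : ℝ) - ∏ l, p l)) =
      Literature.NumberTheory.DiophantineApproximation.DilogPade.polylogSeries (i + 1) (1 / (N : ℝ)) := fun i => by
    rw [stub_cubeIntegralSeriesLevel (i + 1) (N : ℝ) hNR,
      Literature.NumberTheory.DiophantineApproximation.DilogPade.polylogSeries]
  have IM : ∀ i, (∫ p in cube (i + 1), 1 / ((-(N : ℝ)) - ∏ l, p l)) =
      Literature.NumberTheory.DiophantineApproximation.DilogPade.polylogSeries (i + 1) (-(1 / (N : ℝ))) := fun i => by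
    rw [integral_cube_one_div_prod_absLevel (i + 1) (-(N : ℝ)) (by rw [abs_neg, Nat.abs_cast]; linarith),
      Literature.NumberTheory.DiophantineApproximation.DilogPade.polylogSeries]
    refine tsum_congr fun k => ?_
    rw [one_div_neg_eq_neg_one_div]
  simp_rw [IP, IM] at h
  have key := Literature.NumberTheory.DiophantineApproximation.one_polylog_twoPoints_linearIndependent w hw N hlog a
    (fun j : Fin w => b j) (fun j : Fin w => c j) (by
      rw [Finset.sum_range (fun i => (b i : ℝ) *
          Literature.NumberTheory.DiophantineApproximation.DilogPade.polylogSeries (i + 1) (1 / (N : ℝ))),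
        Finset.sum_range (fun i => (c i : ℝ) *
          Literature.NumberTheory.DiophantineApproximation.DilogPade.polylogSeries (i + 1) (-(1 / (N : ℝ))))] at h
      exact h)
  obtain ⟨ha, hb, hc⟩ := key
  refine ⟨ha, fun i hi => ?_, fun i hi => ?_⟩
  · have := congrFun hb ⟨i, Finset.mem_range.1 hi⟩
    simpa using this
  · have := congrFun hc ⟨i, Finset.mem_range.1 hi⟩
    simpa using this

end Summit.KontsevichZagierPeriods.HermiteRigidity.ReductionRigidity

end
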